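import Summits.HodgeConjecture.CorCM.HypDel.M1primeOfFUPart6   -- E-FU part 6
import Literature.AlgebraicGeometry.Motives.CyclesBaseChange   -- ★ `Motives.isPullback_baseChangeHom_map_left` (v10s: replaces the § 3a file-private pasting lemma across the Part 6 → Part 7 boundary)
import Literature.AlgebraicGeometry.Motives.UniversalHypersurfaceQuasiProjective   -- ★ `IsQuasiProjectiveOver.of_isOpenImmersion` (v10s: replaces B-p05’s file-private copy, used in Part 7 and the HEAD)

/-!
# M1′ from (F) and (U) — E-FU PART 7 of 7 (+ HEAD `M1primeOfFU`): 
§ 3b — W1c/W1e/W1f (B-p05 g10): the abelian variety of a triple, analytification and quasi-projectivity of the pieces, `pieceDatum`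

Cell hodgecm-mathlib, rung 0 of the Mumford line under `HDel` (item `stmt-HodgeConjecture-24835`).  The E-FU text proves
`deligne1971_siegelModuliOnPoints` (M1′ = [Deligne 1971, 4.16–4.21 on points]) as a THEOREM of the two finer printed facts
(F) `lan2013_siegelFineModuliScheme` [Lan 2013, Thm. 1.4.1.11 + Cor. 7.2.3.9] and (U) `siegelModuli_complexUniformisation`
[MFK94 App. 7A; Deligne 1971, 4.12–4.21; Milne 2005 Thm. 6.11]; it is split into a chain of part files only because of the
400-line cap on proof-bearing `Summits/` files (B-plan1 R22, director s96).  The composition and `theorem M1prime_of_F_U` live in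
the HEAD file `Summits/HodgeConjecture/CorCM/HypDel/M1primeOfFU.lean`; provenance of every § is kept in its banner below and in
HOME `B-plan/lines/m1prime/M1primeOfFU.skeleton.md`.  This part imports (F)/(U).
HC_CM is proved only modulo the 7 printed citations until rung 0 closes.
-/

universe u   -- was declared inside the dropped D1 paste
open CategoryTheory CategoryTheory.Limits AlgebraicGeometry MonoidalCategory   -- was a TOP-LEVEL `open` of the dropped D1 paste (and of (M)); the pasted (F)/(U)/partC/§§ rely on it

/- ═════ B-p05 (g10, W1 pen) — W1c: THE ABELIAN VARIETY OF A TRIPLE OVER `Spec ℂ`, SMOOTH-PROJECTIVITY OF THE COMPLEXIFIED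
   UNIVERSAL FAMILY, AND THE PIECE FAMILIES' FIBRES (census D4 / D9; HOME-only by paste). ═════ -/

namespace Literature.AlgebraicGeometry.ModuliOfAbelianVarieties

namespace W1

open CategoryTheory CategoryTheory.Limits Matrix Topology AlgebraicGeometry
open scoped Matrix.Norms.Elementwise
open Literature.AlgebraicGeometry.Motives (SchemeOver ComplexPoints AlgPoints specOver AbelianVariety CartierDivisor
  baseChangeHom baseChangeHomFst fiberOver fiberι fiberOverToSpec fiberOverBaseChangeIsoOfIsPullback IsSmoothProjective
  IsSmoothProjectiveFamily familyPullback fiberOverFamilyPullbackIso)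
open Literature.AlgebraicGeometry.HodgeTheory (IsQuasiProjectiveOver)
open Literature.AlgebraicGeometry.AbelianSchemes (PolarizedAbelianSchemeWithLevel AbelianSchemeOver)
open Literature.Geometry.Kaehler (ComplexTorus)
open Literature.NumberTheory.Transcendental (IsAnalytification)
open Literature.NumberTheory.Automorphic (siegelUpperHalfSpace)
open Literature.NumberTheory.Adeles (latticeOfGL)
open SiegelModuli (jOfSiegel)

variable {g N : ℕ} {δ : Fin g → ℕ}

/-! ### The abelian variety of a triple over `Spec ℂ` -/

/-- The ABELIAN VARIETY of a triple over `Spec ℂ`: the affine reading of its abelian scheme (D1 `toAffine` — the base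
`(specOver ℚ ℂ).left` IS `Spec ℂ` — followed by ★ `AbelianScheme.toAbelianVariety`); its underlying `ℂ`-scheme is
`P′.A.X` ON THE NOSE. [cite: MumfordFogartyKirwan1994, Ch. 6 §1 Definition 6.1 (p. 115)] -/
noncomputable def tripleAV (P' : PolarizedAbelianSchemeWithLevel g N δ (specOver ℚ ℂ).left) : AbelianVariety ℂ :=
  (AbelianSchemeOver.toAffine (R := ℂ) P'.A).toAbelianVariety

/-- **The abelian variety of a triple has dimension `g`** (the triple's `relDim : IsOfRelDim g` read over the field `ℂ`;
uniqueness of the relative dimension of a smooth morphism with non-empty source, ★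
`AbelianVarietyProofs.eq_of_smoothOfRelativeDimension`). [cite: GortzWedhorn2020, Remark 16.54 (p. 678)] -/
theorem tripleAV_dim (P' : PolarizedAbelianSchemeWithLevel g N δ (specOver ℚ ℂ).left) : (tripleAV P').dim = g := by
  have h₁ : SmoothOfRelativeDimension g (tripleAV P').X.hom := (P'.A.isOfRelDim_iff g).1 P'.relDim
  have h₂ : SmoothOfRelativeDimension (tripleAV P').dim (tripleAV P').X.hom := (tripleAV P').smoothOfRelativeDimension_dim
  haveI := (tripleAV P').irreducibleSpace_left
  exact Motives.AbelianVarietyProofs.eq_of_smoothOfRelativeDimension _ h₂ h₁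

/-- **The abelian scheme of a triple over `Spec ℂ` is a smooth projective `ℂ`-variety of dimension `g`** (★
`isSmoothProjective_holds` for abelian varieties + `tripleAV_dim`). [cite: MumfordAV1970, §4 (ii) and §6 Application 1 (p. 62)] -/
theorem isSmoothProjective_tripleA (P' : PolarizedAbelianSchemeWithLevel g N δ (specOver ℚ ℂ).left) :
    IsSmoothProjective g (P'.A.X : SchemeOver ℂ) := by
  have h : (tripleAV P').isSmoothProjective := AbelianVariety.isSmoothProjective_holds
  rw [AbelianVariety.isSmoothProjective, tripleAV_dim] at h
  exact h

/-! ### The (U)-clauses as named hypotheses (unpacked once; W1's internal currency) -/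

/-- The (U3∃)(b) clause of (U) v0.5 for GIVEN witnesses `(S, ι, unif)` — a `Prop` abbreviation so that W1's lemmas take the
unpacked uniformisation as hypotheses (the final assembly destructs `siegelModuli_complexUniformisation` once).
[cite: MumfordFogartyKirwan1994, Appendix to Ch. 7 §A (p. 235)] -/
def U3Exists (hδ : IsPolarizationType δ) (𝓜 : SiegelFineModuliScheme g N δ) (S : (ZMod N)ˣ → SchemeOver ℂ)
    (ι : ∀ c, S c ⟶ (Motives.baseChange ℚ ℂ).obj 𝓜.M)
    (unif : ∀ _c : (ZMod N)ˣ, Matrix (Fin g) (Fin g) ℂ → ComplexPoints (S _c)) : Prop :=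
  ∀ (c : (ZMod N)ˣ) (u : finAdeleQˣ) (r : gspFinAdelic δ),
    (∀ v, Valued.v ((u : finAdeleQ) v) = 1) →
    (u : finAdeleQ) - ((c : ZMod N).val : ℕ) ∈ levelIdeal N →
    r ∈ principalLevelSubgroup δ 1 →
    IsMultiplier (typeFormOver δ finAdeleQ) (r : GL (Fin g ⊕ Fin g) finAdeleQ) u →
    ((r : GL (Fin g ⊕ Fin g) finAdeleQ) : Matrix (Fin g ⊕ Fin g) (Fin g ⊕ Fin g) finAdeleQ) =
      Matrix.fromBlocks 1 0 0 ((u : finAdeleQ) • (1 : Matrix (Fin g) (Fin g) finAdeleQ)) →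
    ∀ (Z : Matrix (Fin g) (Fin g) ℂ) (hZ : Z ∈ siegelUpperHalfSpace g),
      ∃ (P' : PolarizedAbelianSchemeWithLevel g N δ (specOver ℚ ℂ).left)
        (G : P'.A.X.left ⟶ 𝓜.univ.A.X.left) (Ĝ : P'.D.hat.X.left ⟶ 𝓜.univ.D.hat.X.left),
        P'.IsBaseChangeVia 𝓜.univ
            ((AlgPoints.baseChangeEquiv (algebraMap ℚ ℂ) 𝓜.M).symm (AlgPoints.map (ι c) (unif c Z))).left G Ĝ ∧
          IsAdmissibleAt hδ r Z hZ P'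

/-! ### The complexified universal family is a smooth projective family of relative dimension `g` -/

section Family

variable (hδ : IsPolarizationType δ) (𝓜 : SiegelFineModuliScheme g N δ) {S : (ZMod N)ˣ → SchemeOver ℂ}
  {ι : ∀ c, S c ⟶ (Motives.baseChange ℚ ℂ).obj 𝓜.M} {unif : ∀ c : (ZMod N)ˣ, Matrix (Fin g) (Fin g) ℂ → ComplexPoints (S c)}

/-- **Every complex point of `𝓜.M ⊗ ℂ` is `(ι c)(ℂ)(unif_c Z)`** for some piece `c` and `Z ∈ 𝔥_g` ((U1) cofan + (U2+) `surjOn`;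
★ `Motives.exists_sigmaHomeomorph_of_isColimit_cofan`). [cite: MumfordFogartyKirwan1994, Appendix to Ch. 7 §A (p. 235)] -/
theorem exists_eq_map_unif (hcof : IsColimit (Cofan.mk ((Motives.baseChange ℚ ℂ).obj 𝓜.M) ι))
    (hsurj : ∀ c, Set.SurjOn (unif c) (siegelUpperHalfSpace g) Set.univ)
    (t : ComplexPoints ((Motives.baseChange ℚ ℂ).obj 𝓜.M)) :
    ∃ (c : (ZMod N)ˣ) (Z : Matrix (Fin g) (Fin g) ℂ), Z ∈ siegelUpperHalfSpace g ∧ t = AlgPoints.map (ι c) (unif c Z) := by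
  obtain ⟨Φ, hΦ⟩ := Motives.exists_sigmaHomeomorph_of_isColimit_cofan ℂ hcof
  obtain ⟨⟨c, Q⟩, hcQ⟩ := Φ.surjective t
  obtain ⟨Z, hZ, hZQ⟩ := hsurj c (Set.mem_univ Q)
  exact ⟨c, Z, hZ, by rw [← hcQ, hΦ, hZQ]⟩

/-- **Every fibre of the complexified universal family over a complex point is the abelian scheme of an ADMISSIBLE triple**
(the point is `unif_c Z` by `exists_eq_map_unif`; (U3∃)(b) at a principal representative of `c` — ★ `exists_principalRep` — and
`fiberUnivIsoOfIsBaseChangeVia`). [cite: MumfordFogartyKirwan1994, Appendix to Ch. 7 §A (p. 235)] [cite: Milne2005ShimuraVarieties, §6 Thm. 6.11 p. 74] -/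
theorem exists_admissible_iso_fiberUniv (hN : 3 ≤ N) (hcof : IsColimit (Cofan.mk ((Motives.baseChange ℚ ℂ).obj 𝓜.M) ι))
    (hsurj : ∀ c, Set.SurjOn (unif c) (siegelUpperHalfSpace g) Set.univ) (hU3 : U3Exists hδ 𝓜 S ι unif)
    (t : ComplexPoints ((Motives.baseChange ℚ ℂ).obj 𝓜.M)) :
    ∃ (c : (ZMod N)ˣ) (r : gspFinAdelic δ) (Z : Matrix (Fin g) (Fin g) ℂ) (hZ : Z ∈ siegelUpperHalfSpace g)
      (P' : PolarizedAbelianSchemeWithLevel g N δ (specOver ℚ ℂ).left),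
      r ∈ principalLevelSubgroup δ 1 ∧ t = AlgPoints.map (ι c) (unif c Z) ∧ IsAdmissibleAt hδ r Z hZ P' ∧
        Nonempty (fiberOver (univFamilyℂ 𝓜) t ≅ P'.A.X) := by
  have hN0 : N ≠ 0 := by omega
  obtain ⟨c, Z, hZ, rfl⟩ := exists_eq_map_unif 𝓜 hcof hsurj t
  obtain ⟨u, r, hu, hua, hr1, hru, hrmat⟩ := exists_principalRep δ hN0 c
  obtain ⟨P', G, Ĝ, hbc, hadm⟩ := hU3 c u r hu hua hr1 hru hrmat Z hZ
  exact ⟨c, r, Z, hZ, P', hr1, rfl, hadm, ⟨fiberUnivIsoOfIsBaseChangeVia 𝓜 _ P' G Ĝ hbc⟩⟩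

/-- **THE COMPLEXIFIED UNIVERSAL FAMILY IS A SMOOTH PROJECTIVE FAMILY OF RELATIVE DIMENSION `g`** (W1, census D4 at the apex):
smooth of relative dimension `g` and proper by base change of the universal abelian scheme's structure morphism (D1 fields,
Mathlib stability under base change along ★ `isPullback_baseChangeHom_map_left`), and every complex fibre is — by (U) — the
abelian scheme of a triple over `Spec ℂ`, a smooth projective variety of dimension `g` (`isSmoothProjective_tripleA`,
★ `IsSmoothProjective.of_iso`). [cite: MumfordFogartyKirwan1994, Ch. 7 §3 Theorem 7.9 (p. 139) and Appendix to Ch. 7 §A (p. 235)] -/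
theorem isSmoothProjectiveFamily_univFamilyℂ (hN : 3 ≤ N)
    (hcof : IsColimit (Cofan.mk ((Motives.baseChange ℚ ℂ).obj 𝓜.M) ι))
    (hsurj : ∀ c, Set.SurjOn (unif c) (siegelUpperHalfSpace g) Set.univ) (hU3 : U3Exists hδ 𝓜 S ι unif) :
    IsSmoothProjectiveFamily (univFamilyℂ 𝓜) g := by
  have sq := Motives.isPullback_baseChangeHom_map_left (algebraMap ℚ ℂ) (univFamily 𝓜)  -- ★ `Motives/CyclesBaseChange` (v10s; the § 3a private copy is module-local to Part 6)
  refine ⟨?_, ?_, fun t => ?_⟩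
  · have h0 : SmoothOfRelativeDimension g (univFamily 𝓜).left := (𝓜.univ.A.isOfRelDim_iff g).1 𝓜.univ.relDim
    haveI := smoothOfRelativeDimension_isStableUnderBaseChange (n := g)
    exact MorphismProperty.IsStableUnderBaseChange.of_isPullback sq h0
  · have h0 : IsProper (univFamily 𝓜).left := 𝓜.univ.A.isProper
    exact MorphismProperty.IsStableUnderBaseChange.of_isPullback sq h0
  · obtain ⟨c, r, Z, hZ, P', -, -, -, ⟨e⟩⟩ := exists_admissible_iso_fiberUniv hδ 𝓜 hN hcof hsurj hU3 t
    exact (isSmoothProjective_tripleA P').of_iso e.symm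

/-! ### The piece families and their fibres -/

/-- The universal family RESTRICTED TO THE PIECE `c`: the pull-back of `X ⊗ ℂ → M ⊗ ℂ` along `ι c : S_c → M ⊗ ℂ`
(★ `HodgeTheory.familyPullback.snd`) — W1's `(datum K c).f`. [cite: MumfordFogartyKirwan1994, Appendix to Ch. 7 §A (p. 235)] -/
noncomputable def pieceFamily (c : (ZMod N)ˣ) : familyPullback (univFamilyℂ 𝓜) (ι c) ⟶ S c :=
  familyPullback.snd (univFamilyℂ 𝓜) (ι c)

/-- **The piece families are smooth projective families of relative dimension `g`** (base change of the apex family, ★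
`IsSmoothProjectiveFamily.familyPullback_snd`). [cite: MumfordFogartyKirwan1994, Appendix to Ch. 7 §A (p. 235)] -/
theorem isSmoothProjectiveFamily_pieceFamily (hN : 3 ≤ N)
    (hcof : IsColimit (Cofan.mk ((Motives.baseChange ℚ ℂ).obj 𝓜.M) ι))
    (hsurj : ∀ c, Set.SurjOn (unif c) (siegelUpperHalfSpace g) Set.univ) (hU3 : U3Exists hδ 𝓜 S ι unif) (c : (ZMod N)ˣ) :
    IsSmoothProjectiveFamily (pieceFamily 𝓜 (ι := ι) c) g :=
  (isSmoothProjectiveFamily_univFamilyℂ hδ 𝓜 hN hcof hsurj hU3).familyPullback_snd (ι c)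

/-- **`exists_abelianVariety_fibre` FOR THE PIECE FAMILIES (census D9)**: every complex fibre of the restricted universal family is
(isomorphic to the underlying scheme of) a complex abelian variety of dimension `g` — the abelian variety of the admissible triple
at that point (★ `fiberOverFamilyPullbackIso` + `exists_admissible_iso_fiberUniv` + `tripleAV`).
[cite: MumfordFogartyKirwan1994, Ch. 6 §1 (p. 115) and Appendix to Ch. 7 §A (p. 235)] -/
theorem exists_abelianVariety_fibre_pieceFamily (hN : 3 ≤ N)
    (hcof : IsColimit (Cofan.mk ((Motives.baseChange ℚ ℂ).obj 𝓜.M) ι))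
    (hsurj : ∀ c, Set.SurjOn (unif c) (siegelUpperHalfSpace g) Set.univ) (hU3 : U3Exists hδ 𝓜 S ι unif) (c : (ZMod N)ˣ)
    (s : ComplexPoints (S c)) :
    ∃ A : AbelianVariety ℂ, A.dim = g ∧ Nonempty (A.X ≅ fiberOver (pieceFamily 𝓜 (ι := ι) c) s) := by
  obtain ⟨c', r, Z, hZ, P', -, -, -, ⟨e⟩⟩ :=
    exists_admissible_iso_fiberUniv hδ 𝓜 hN hcof hsurj hU3 (AlgPoints.map (ι c) s)
  exact ⟨tripleAV P', tripleAV_dim P', ⟨(fiberOverFamilyPullbackIso (univFamilyℂ 𝓜) (ι c) s ≪≫ e).symm⟩⟩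

end Family

end W1

end Literature.AlgebraicGeometry.ModuliOfAbelianVarieties

/- ═════ B-p05 (g10, W1 pen) — W1e: `exists_isAnalytification_fibre` FOR THE PIECE FAMILIES (census D16, assembled). ═════ -/

namespace Literature.AlgebraicGeometry.ModuliOfAbelianVarieties

namespace W1

open CategoryTheory CategoryTheory.Limits Matrix Topology AlgebraicGeometry
open scoped Matrix.Norms.Elementwise Manifold ContDiff
open Literature.AlgebraicGeometry.Motives (SchemeOver ComplexPoints AlgPoints specOver AbelianVariety CartierDivisor
  fiberOver IsSmoothProjective familyPullback fiberOverFamilyPullbackIso)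
open Literature.AlgebraicGeometry.AbelianSchemes (PolarizedAbelianSchemeWithLevel AbelianSchemeOver)
open Literature.Geometry.Kaehler (ComplexTorus)
open Literature.NumberTheory.Transcendental (IsAnalytification)
open Literature.NumberTheory.Automorphic (siegelUpperHalfSpace)
open SiegelModuli (jOfSiegel)

variable {g N : ℕ} {δ : Fin g → ℕ}

/-- The abelian variety READ BY A MARKING of an admissible triple: the fibre of `P′.A` at the identity point of `Spec ℂ`
(D1 `fibre (𝟙 _)`, ★ `toAbelianVariety`); its underlying `ℂ`-scheme is `(Over.pullback (𝟙 _)).obj P′.A.X` on the nose.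
[cite: MumfordFogartyKirwan1994, Ch. 6 §1 Definition 6.1 (p. 115)] -/
noncomputable def fibreAV (P' : PolarizedAbelianSchemeWithLevel g N δ (specOver ℚ ℂ).left) : AbelianVariety ℂ :=
  (P'.A.fibre (𝟙 (Spec (CommRingCat.of ℂ)))).toAbelianVariety

/-- `(fibreAV P′).dim = g` (relative dimension is stable under base change and is the dimension over a field).
[cite: GortzWedhorn2020, Remark 16.54 (p. 678)] -/
theorem fibreAV_dim (P' : PolarizedAbelianSchemeWithLevel g N δ (specOver ℚ ℂ).left) : (fibreAV P').dim = g := by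
  have h₁ : SmoothOfRelativeDimension g (fibreAV P').X.hom := P'.relDim.fibre (𝟙 (Spec (CommRingCat.of ℂ)))
  have h₂ : SmoothOfRelativeDimension (fibreAV P').dim (fibreAV P').X.hom := (fibreAV P').smoothOfRelativeDimension_dim
  haveI := (fibreAV P').irreducibleSpace_left
  exact Motives.AbelianVarietyProofs.eq_of_smoothOfRelativeDimension _ h₂ h₁

/-- `(fibreAV P′).X ≅ P′.A.X` — pull-back along the identity (Mathlib `Over.pullbackId`). [folklore] -/
noncomputable def fibreAVIso (P' : PolarizedAbelianSchemeWithLevel g N δ (specOver ℚ ℂ).left) : (fibreAV P').X ≅ P'.A.X :=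
  Over.pullbackId.app P'.A.X

section Analytification

variable (hδ : IsPolarizationType δ) (𝓜 : SiegelFineModuliScheme g N δ) {S : (ZMod N)ˣ → SchemeOver ℂ}
  {ι : ∀ c, S c ⟶ (Motives.baseChange ℚ ℂ).obj 𝓜.M} {unif : ∀ c : (ZMod N)ˣ, Matrix (Fin g) (Fin g) ℂ → ComplexPoints (S c)}

/-- **`exists_isAnalytification_fibre` FOR THE PIECE FAMILIES (census D16), from (F)'s `classify` + (U) v0.5**: for every piece
`c`, every `Z ∈ 𝔥_g` and every presentation `Φ` of the Siegel period isomorphism `Φ_Z`, the fibre of the restricted universal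
family over `unif_c Z` is analytified by the Siegel torus `ℂ^g/Φ(ℤ^{2g})`.  Road: (U3∃)(b) at a principal representative `r` of
`c` gives an admissible triple `P′` classified by `unif_c Z` with a marking `m` of its fibre `A₀` by `[J(Z), r]`; the marking
IS an analytification `ℂ^g/Ψ_m(ℤ^{2g}) → A₀(ℂ)`; the Siegel torus is biholomorphic to `ℂ^g/Ψ_m(ℤ^{2g})`
(`SiegelAdelicMarking.exists_homeomorph_siegelTorus`, ★ `IsAnalytification.comp_of_isHomeomorph`); and `A₀ ≅ P′.A ≅` the fibre
of `X ⊗ ℂ → M ⊗ ℂ` at `ι_c (unif_c Z)` (`fiberUnivIsoOfIsBaseChangeVia`) `≅` the fibre of the piece family (★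
`fiberOverFamilyPullbackIso`), along which analytifications transport (★ `IsAnalytification.transport_iso`).
[cite: MumfordFogartyKirwan1994, Appendix to Ch. 7 §A (p. 235)] [cite: LangeBirkenhake1992, Ch. 8 §8.1]
[cite: Milne2005ShimuraVarieties, §6 Thm. 6.11 p. 74] -/
theorem exists_isAnalytification_fibre_pieceFamily (hN : 3 ≤ N) (hU3 : U3Exists hδ 𝓜 S ι unif) (c : (ZMod N)ˣ)
    (Z : Matrix (Fin g) (Fin g) ℂ) (hZ : Z ∈ siegelUpperHalfSpace g)
    (Φ : (Fin g ⊕ Fin g → ℝ) ≃L[ℝ] (Fin g → ℂ)) (hΦ : ∀ v, Φ v = siegelPeriodMap δ Z v) :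
    ∃ φ : ComplexTorus Φ → ComplexPoints (fiberOver (pieceFamily 𝓜 (ι := ι) c) (unif c Z)),
      IsAnalytification (Fin g → ℂ) (fiberOver (pieceFamily 𝓜 (ι := ι) c) (unif c Z)) g φ := by
  have hN0 : N ≠ 0 := by omega
  obtain ⟨u, r, hu, hua, hr1, hru, hrmat⟩ := exists_principalRep δ hN0 c
  obtain ⟨P', G, Ĝ, hbc, m, Θ, Λ, -, -, -⟩ := hU3 c u r hu hua hr1 hru hrmat Z hZ
  obtain ⟨e, he, -⟩ := SiegelAdelicMarking.exists_homeomorph_siegelTorus hδ.1 hZ hr1 m Φ hΦ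
  have hψ : IsAnalytification (Fin g → ℂ) (fibreAV P').X (fibreAV P').dim (m.toFun ∘ e) :=
    m.isAnalytification.comp_of_isHomeomorph e.isHomeomorph (he.mdifferentiable (by simp)) rfl
  rw [fibreAV_dim] at hψ
  let eX : (fibreAV P').X ≅ fiberOver (pieceFamily 𝓜 (ι := ι) c) (unif c Z) :=
    fibreAVIso P' ≪≫ (fiberUnivIsoOfIsBaseChangeVia 𝓜 _ P' G Ĝ hbc).symm ≪≫
      (fiberOverFamilyPullbackIso (univFamilyℂ 𝓜) (ι c) (unif c Z)).symm
  exact ⟨AlgPoints.map eX.hom ∘ (m.toFun ∘ e), hψ.transport_iso eX⟩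

end Analytification

end W1

end Literature.AlgebraicGeometry.ModuliOfAbelianVarieties

/- ═════ B-p05 (g10, W1 pen) — W1f: QUASI-PROJECTIVITY / SMOOTHNESS OF THE PIECES AND THEIR FAMILIES (census D5/D6/D8) AND THE
   ONE-PIECE RECORD `pieceDatum : SiegelModuliDatum g δ N` FROM (F) + (U).  HOME-only by paste. ═════ -/

namespace Literature.AlgebraicGeometry.ModuliOfAbelianVarieties

namespace W1

open CategoryTheory CategoryTheory.Limits Matrix Topology AlgebraicGeometry
open scoped Matrix.Norms.Elementwise
open Literature.AlgebraicGeometry.Motives (SchemeOver ComplexPoints AlgPoints specOver AbelianVariety CartierDivisor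
  baseChangeHom baseChangeHomFst fiberOver IsSmoothProjective IsSmoothProjectiveFamily familyPullback fiberOverFamilyPullbackIso)
open Literature.AlgebraicGeometry.HodgeTheory (IsQuasiProjectiveOver)
open Literature.AlgebraicGeometry.AbelianSchemes (PolarizedAbelianSchemeWithLevel AbelianSchemeOver)
open Literature.Geometry.Kaehler (ComplexTorus)
open Literature.NumberTheory.Transcendental (IsAnalytification)
open Literature.NumberTheory.Automorphic (siegelUpperHalfSpace)
open SiegelModuli (jOfSiegel)

variable {g N : ℕ} {δ : Fin g → ℕ}

-- (v10s) the former file-private copies `isQuasiProjectiveOver_baseChangeHom'` / `isQuasiProjectiveOver_of_isOpenImmersion` are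
-- replaced BY NAME by ★ `IsQuasiProjectiveOver.baseChangeHom` (`HodgeTheory/HodgeGenericQbarDescentProofs`) and ★
-- `IsQuasiProjectiveOver.of_isOpenImmersion` (`Motives/UniversalHypersurfaceQuasiProjective`): a `private` lemma is invisible across the
-- Road-S part boundary (Part 7 → HEAD), and the tree already proves both.

section Pieces

variable (𝓜 : SiegelFineModuliScheme g N δ) {S : (ZMod N)ˣ → SchemeOver ℂ} {ι : ∀ c, S c ⟶ (Motives.baseChange ℚ ℂ).obj 𝓜.M}

/-- The legs of the (U1) cofan are OPEN IMMERSIONS (★ `Morphisms.isOpenImmersion_of_isColimit_cofan`). [cite: GortzWedhorn2020, §(3.5) Example 3.11 (p. 73)] -/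
theorem isOpenImmersion_ι (hcof : IsColimit (Cofan.mk ((Motives.baseChange ℚ ℂ).obj 𝓜.M) ι)) (c : (ZMod N)ˣ) :
    IsOpenImmersion (ι c).left := by
  obtain ⟨hc'⟩ := Morphisms.isColimit_cofan_left hcof
  exact Morphisms.isOpenImmersion_of_isColimit_cofan hc' c

/-- **The pieces are quasi-projective** (census D6): open in `M ⊗ ℂ`, which is quasi-projective by (F-c′) and base change.
[cite: MumfordFogartyKirwan1994, Ch. 7 §3 Theorem 7.9 (p. 139)] -/
theorem isQuasiProjectiveOver_piece (hM : IsQuasiProjectiveOver 𝓜.M)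
    (hcof : IsColimit (Cofan.mk ((Motives.baseChange ℚ ℂ).obj 𝓜.M) ι)) (c : (ZMod N)ˣ) : IsQuasiProjectiveOver (S c) := by
  haveI := isOpenImmersion_ι 𝓜 hcof c
  exact IsQuasiProjectiveOver.of_isOpenImmersion (ι c) (IsQuasiProjectiveOver.baseChangeHom (algebraMap ℚ ℂ) hM)

/-- **The pieces are smooth over `ℂ`** (census D8): an open immersion into the smooth `M ⊗ ℂ` ((F-c′) + base change).
[cite: Lan2013PELCompactifications, Thm. 1.4.1.11] -/
theorem smooth_piece (hM : Smooth 𝓜.M.hom) (hcof : IsColimit (Cofan.mk ((Motives.baseChange ℚ ℂ).obj 𝓜.M) ι)) (c : (ZMod N)ˣ) :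
    Smooth (S c).hom := by
  haveI := isOpenImmersion_ι 𝓜 hcof c
  have hbc : Smooth ((Motives.baseChange ℚ ℂ).obj 𝓜.M).hom := by
    change Smooth (pullback.snd 𝓜.M.hom (Spec.map (CommRingCat.ofHom (algebraMap ℚ ℂ))))
    exact MorphismProperty.pullback_snd (P := @Smooth) _ _ hM
  rw [← Over.w (ι c)]
  exact inferInstance

/-- **The total space of a piece family is quasi-projective** (census D5): open in `X ⊗ ℂ` (base change of the open leg `ι c`),
which is quasi-projective by (F-c″) and base change. [cite: MumfordFogartyKirwan1994, Ch. 7 §3 Theorem 7.9 and Prop. 7.3 (pp. 131–139)] -/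
theorem isQuasiProjectiveOver_pieceTotal (hX : IsQuasiProjectiveOver (univTotal 𝓜))
    (hcof : IsColimit (Cofan.mk ((Motives.baseChange ℚ ℂ).obj 𝓜.M) ι)) (c : (ZMod N)ˣ) :
    IsQuasiProjectiveOver (familyPullback (univFamilyℂ 𝓜) (ι c)) := by
  haveI := isOpenImmersion_ι 𝓜 hcof c
  haveI : IsOpenImmersion (familyPullback.fst (univFamilyℂ 𝓜) (ι c)).left := by
    change IsOpenImmersion (pullback.fst (univFamilyℂ 𝓜).left (ι c).left)
    infer_instance
  exact IsQuasiProjectiveOver.of_isOpenImmersion (familyPullback.fst (univFamilyℂ 𝓜) (ι c))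
    (IsQuasiProjectiveOver.baseChangeHom (algebraMap ℚ ℂ) hX)

end Pieces

/-! ### The one-piece record -/

section Record

variable (hδ : IsPolarizationType δ) (𝓜 : SiegelFineModuliScheme g N δ) {S : (ZMod N)ˣ → SchemeOver ℂ}
  {ι : ∀ c, S c ⟶ (Motives.baseChange ℚ ℂ).obj 𝓜.M} {unif : ∀ c : (ZMod N)ˣ, Matrix (Fin g) (Fin g) ℂ → ComplexPoints (S c)}

/-- **THE SIEGEL FINE MODULI DATUM OF THE PIECE `c`, CONSTRUCTED FROM (F) + (U)** (W1, census D1–D16): base `S_c`, the universal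
family restricted to `S_c`, the uniformisation `unif_c` — every field of ★ `SiegelModuliDatum g δ N` discharged: the family fields
by D1/D4 base change and (U3∃)(b) (`isSmoothProjectiveFamily_pieceFamily`, `exists_abelianVariety_fibre_pieceFamily`,
`exists_isAnalytification_fibre_pieceFamily`), the base fields by (F-c′)(F-c″) and the (U1) cofan, the `unif` fields VERBATIM from
(U2+). [cite: MumfordFogartyKirwan1994, Ch. 7 §3 Theorem 7.9 (p. 139) and Appendix to Ch. 7 §A (pp. 234–235)]
[cite: Milne2005ShimuraVarieties, §6 Thm. 6.11 p. 74] [cite: GenestierNgo2020, Prop. 1.3.2] -/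
noncomputable def pieceDatum (hN : 3 ≤ N) (hMs : Smooth 𝓜.M.hom) (hMq : IsQuasiProjectiveOver 𝓜.M)
    (hXq : IsQuasiProjectiveOver (univTotal 𝓜)) (hcof : IsColimit (Cofan.mk ((Motives.baseChange ℚ ℂ).obj 𝓜.M) ι))
    (hirr : ∀ c, IrreducibleSpace (S c).left)
    (hU2 : ∀ c, ContinuousOn (unif c) (siegelUpperHalfSpace g) ∧
            IsOpenMap ((siegelUpperHalfSpace g).restrict (unif c)) ∧
            Set.SurjOn (unif c) (siegelUpperHalfSpace g) Set.univ ∧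
            (∀ Z ∈ siegelUpperHalfSpace g, ∀ Z' ∈ siegelUpperHalfSpace g,
              unif c Z = unif c Z' ↔ ∃ M ∈ siegelLevelGroup δ N, ∃ C : (Fin g → ℂ) ≃ₗ[ℂ] (Fin g → ℂ),
                ∀ v : Fin g ⊕ Fin g → ℝ, C (siegelPeriodMap δ Z v) = siegelPeriodMap δ Z' (intAct M v)) ∧
            ∀ (U : (S c).left.affineOpens) (s : (S c).left.presheaf.obj (Opposite.op (↑U : (S c).left.Opens))),
              DifferentiableOn ℂ (fun Z ↦ AlgPoints.evalOrZero (↑U : (S c).left.Opens) s (unif c Z))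
                (siegelUpperHalfSpace g ∩ unif c ⁻¹' {P | P.pt ∈ (↑U : (S c).left.Opens)}))
    (hU3 : U3Exists hδ 𝓜 S ι unif) (c : (ZMod N)ˣ) : SiegelModuliDatum g δ N where
  S := S c
  𝒳 := familyPullback (univFamilyℂ 𝓜) (ι c)
  f := pieceFamily 𝓜 (ι := ι) c
  isSmoothProjectiveFamily := isSmoothProjectiveFamily_pieceFamily hδ 𝓜 hN hcof (fun c => (hU2 c).2.2.1) hU3 c
  isQuasiProjectiveOver_total := isQuasiProjectiveOver_pieceTotal 𝓜 hXq hcof c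
  isQuasiProjectiveOver_base := isQuasiProjectiveOver_piece 𝓜 hMq hcof c
  irreducibleSpace_base := hirr c
  smooth_base := smooth_piece 𝓜 hMs hcof c
  exists_abelianVariety_fibre := exists_abelianVariety_fibre_pieceFamily hδ 𝓜 hN hcof (fun c => (hU2 c).2.2.1) hU3 c
  unif := unif c
  continuousOn_unif := (hU2 c).1
  isOpenMap_unif := (hU2 c).2.1
  surjOn_unif := (hU2 c).2.2.1
  unif_eq_unif_iff := (hU2 c).2.2.2.1
  differentiableOn_unif := (hU2 c).2.2.2.2
  exists_isAnalytification_fibre := fun Z hZ Φ hΦ => exists_isAnalytification_fibre_pieceFamily hδ 𝓜 hN hU3 c Z hZ Φ hΦ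

end Record

end W1

end Literature.AlgebraicGeometry.ModuliOfAbelianVarieties
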